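import Literature.AnabelianGeometry.EtaleTheta.ConstantMultipleRigidity
import Literature.AnabelianGeometry.EtaleTheta.SettingGaloisFacts
import Literature.AnabelianGeometry.EtaleTheta.ThetaCyclotomes
import HarnessLib

/-!
# [EtTh] §1, Def. 1.7: the group theory of the coverings `Ÿ → Ẍ → Ẋ → X → C`, `Ẋ → Ċ → C`
# (support for the discharge of Prop. 1.8 / Thm. 1.10 modulo their anabelian inputs)

Mochizuki, *The étale theta function …*, Publ. RIMS **45** (2009), §1, Def. 1.7, PRIMS PDF p. 27
(printed 253), with the proof of Prop. 1.8, pp. 28–29 [cite: MochizukiEtTh2009, Def 1.7 p.27].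
Layer L2 of the abc-iut cell, seat abc-iut-L2-t1 (discharge wave, node `EtTh:Prop1.8`). PROOF-ONLY
companion (no `def`) of `ConstantMultipleRigidity.lean` (`MuTwoSetting`, `dotX`, `dotC`,
`IsAdmissibleEpsZ`) over the root `Setting.lean`; continued by `Discharge/Sec1Prop18.lean`.

PROVED here — the parts of the printed proof of Prop. 1.8 that are group theory inside `Π^tp_C`
("[as is easily verified]", p. 28; "compatible with the natural inclusions among these subgroups",
p. 28; "compatible with the subgroups `Π^tp_Ÿ ⊆ Π^tp_Ẍ ⊆ Π^tp_X`", p. 29):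
* `dotX_normal`, `dotC_normal`, `normal_of_map_GtpXdd_le` — every subgroup of `Π^tp_C` containing
  `Π^tp_Ẍ` is normal ("`Ẍ^log → C^log` is Galois, with Galois group isomorphic to `(ℤ/2ℤ)³`", p. 27);
* `mem_dotX_iff`, `mem_dotC_iff` — `Π^tp_Ẋ = Π^tp_Ẍ ⊔ Π^tp_Ẍ ε_Z`, `Π^tp_Ċ = Π^tp_Ẋ ⊔ Π^tp_Ẋ ε_± ε_μ`;
* `dotC_inf_range` — **`Π^tp_Ċ ∩ Π^tp_X = Π^tp_Ẋ`** for admissible `ε_Z` ("the square is cartesian", p. 27);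
* under condition (I) `K = K̈` (`sqrtqX_mem_K`): `Kdd_eq_K`, `GKN_two_eq_GK`, `GtpYdd_eq_GtpYN_two`
  (`Π^tp_Ÿ = Π^tp_{Y₂}`), `relIndex_GtpYdd_GtpY` (**`[Π^tp_Y : Π^tp_Ÿ] = 2`**) — the `Sec2Hyps`-versions
  of abc-iut-L2-t8 (`DoubleUnderline.lean`) specialised to the data (I) that `MuTwoSetting` carries;
* `GtpXdd_eq_normalClosure` — **`Π^tp_Ẍ` is the normal subgroup of `Π^tp_X` generated by `Π^tp_Ÿ` and
  the squares** (index count `2 · 2 = 4 = [Π^tp_X : Π^tp_Ẍ]` through `Π^tp_X/Π^tp_Y ≅ ℤ`); hence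
  `map_GtpXdd_eq_of_map_GtpYdd_eq`: an isomorphism `Π^tp_{Xα} →̃ Π^tp_{Xβ}` carrying `Π^tp_Ÿ` to `Π^tp_Ÿ`
  (Thm. 1.6 (i)) carries `Π^tp_Ẍ` to `Π^tp_Ẍ` — print derives this from the cusps ([SemiAnbd] 6.5 (iii)).
Nothing here asserts Prop. 1.8; HONEST FRAMING: typed ≠ proved for [EtTh]; no side is taken on any
disputed claim.
-/

namespace Literature.AnabelianGeometry.EtaleTheta

open Literature.AnabelianGeometry.SemiGraphs

variable {p : ℕ} [Fact p.Prime]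

namespace MuTwoSetting

/-! ### Two lemmas of elementary group theory (private helpers) -/

section GroupTheory

variable {G : Type*} [Group G]

/-- If `N ⊴ G` contains every square of `G` (so that `G/N` is an elementary abelian `2`-group), then
every subgroup `H ⊇ N` is normal in `G`. [folklore] -/
private theorem normal_of_le_of_mul_self_mem {N H : Subgroup G} [N.Normal]
    (hsq : ∀ g : G, g * g ∈ N) (hNH : N ≤ H) : H.Normal := by
  have hinv : ∀ a : G ⧸ N, a⁻¹ = a := fun a => by
    obtain ⟨x, rfl⟩ := QuotientGroup.mk_surjective a
    rw [inv_eq_iff_mul_eq_one, ← QuotientGroup.mk_mul, QuotientGroup.eq_one_iff]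
    exact hsq x
  have hcomm : ∀ a b : G ⧸ N, a * b = b * a := fun a b => by
    calc a * b = (a * b)⁻¹ := (hinv _).symm
      _ = b⁻¹ * a⁻¹ := mul_inv_rev a b
      _ = b * a := by rw [hinv, hinv]
  refine ⟨fun h hh g => ?_⟩
  have hc : g * h * g⁻¹ * h⁻¹ ∈ N := by
    rw [← QuotientGroup.eq_one_iff]
    simp only [QuotientGroup.mk_mul, QuotientGroup.mk_inv]
    rw [hcomm (g : G ⧸ N) (h : G ⧸ N)]
    group
  have : g * h * g⁻¹ = g * h * g⁻¹ * h⁻¹ * h := by group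
  rw [this]
  exact H.mul_mem (hNH hc) hh

/-- For `N ⊴ G` and `e ∈ G` with `e² ∈ N`: `N ⊔ ⟨e⟩ = N ∪ N·e`, i.e. `g ∈ N ⊔ ⟨e⟩` iff `g ∈ N` or
`g e⁻¹ ∈ N`. [folklore] -/
private theorem mem_sup_zpowers_iff_of_mul_self_mem {N : Subgroup G} [N.Normal] {e : G}
    (he : e * e ∈ N) {g : G} : g ∈ N ⊔ Subgroup.zpowers e ↔ g ∈ N ∨ g * e⁻¹ ∈ N := by
  constructor
  · intro hg
    have hg' : g ∈ ((N ⊔ Subgroup.zpowers e : Subgroup G) : Set G) := hg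
    rw [Subgroup.normal_mul] at hg'
    obtain ⟨n, hn, z, hz, rfl⟩ := Set.mem_mul.mp hg'
    obtain ⟨k, rfl⟩ := Subgroup.mem_zpowers_iff.mp hz
    have he2 : e ^ (2 : ℤ) ∈ N := by rw [zpow_two]; exact he
    rcases Int.even_or_odd k with ⟨m, rfl⟩ | ⟨m, rfl⟩
    · left
      have : e ^ (m + m) = (e ^ (2 : ℤ)) ^ m := by rw [← two_mul, zpow_mul]
      rw [this]
      exact N.mul_mem hn (N.zpow_mem he2 m)
    · right
      have : n * e ^ (2 * m + 1) * e⁻¹ = n * (e ^ (2 : ℤ)) ^ m := by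
        rw [zpow_add, zpow_one, zpow_mul]; group
      rw [this]
      exact N.mul_mem hn (N.zpow_mem he2 m)
  · rintro (hg | hg)
    · exact Subgroup.mem_sup_left hg
    · have : g = g * e⁻¹ * e := by group
      rw [this]
      exact (N ⊔ Subgroup.zpowers e).mul_mem (Subgroup.mem_sup_left hg)
        (Subgroup.mem_sup_right (Subgroup.mem_zpowers e))

end GroupTheory

/-! ### Group theory of the configuration of Def. 1.7 inside `Π^tp_C` -/

variable (M : MuTwoSetting p)

/-- `Π^tp_Ẍ ≤ Π^tp_X` inside `Π^tp_C` (`Ẍ^log → X^log`, p. 27). [cite: MochizukiEtTh2009, Def 1.7 p.27] -/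
theorem map_GtpXdd_le_range : M.GtpXdd.map M.inclX ≤ M.inclX.range :=
  Subgroup.map_le_range _ _

/-- `Π^tp_Ẍ ≤ Π^tp_Ẋ` (`Ẍ^log → Ẋ^log`, p. 27). [cite: MochizukiEtTh2009, Def 1.7 p.27] -/
theorem map_GtpXdd_le_dotX (εZ : M.GtpC) : M.GtpXdd.map M.inclX ≤ M.dotX εZ := le_sup_left

/-- `Π^tp_Ẋ ≤ Π^tp_Ċ` (`Ẋ^log → Ċ^log`, p. 27). [cite: MochizukiEtTh2009, Def 1.7 p.27] -/
theorem dotX_le_dotC (εZ : M.GtpC) : M.dotX εZ ≤ M.dotC εZ := le_sup_left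

/-- Every square of `Π^tp_X` lies in `Π^tp_Ẍ` ("`Gal(Ẍ/C) ≅ (ℤ/2ℤ)³`", p. 27, pulled back along
`Π^tp_X ↪ Π^tp_C`). [cite: MochizukiEtTh2009, Def 1.7 p.27] -/
theorem mul_self_mem_GtpXdd (g : M.PiTemp) : g * g ∈ M.GtpXdd := by
  have h := M.sq_mem_GtpXdd (M.inclX g)
  rw [← map_mul, Subgroup.mem_map_iff_mem M.injective_inclX] at h
  exact h

/-- `Π^tp_Ẍ` is normal in `Π^tp_X` ("`Ẍ^log → X^log` … Galois", p. 27). [cite: MochizukiEtTh2009, Def 1.7 p.27] -/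
theorem GtpXdd_normal : M.GtpXdd.Normal := by
  haveI := M.map_GtpXdd_normal
  rw [← Subgroup.comap_map_eq_self_of_injective M.injective_inclX M.GtpXdd]
  infer_instance

/-- Every subgroup of `Π^tp_C` containing `Π^tp_Ẍ` is normal: `Π^tp_C/Π^tp_Ẍ ≅ (ℤ/2ℤ)³` is abelian
("the covering `Ẍ^log → C^log` is Galois, with Galois group isomorphic to `(ℤ/2ℤ)³`", p. 27).
[cite: MochizukiEtTh2009, Def 1.7 p.27] -/
theorem normal_of_map_GtpXdd_le {H : Subgroup M.GtpC} (h : M.GtpXdd.map M.inclX ≤ H) : H.Normal :=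
  haveI := M.map_GtpXdd_normal
  normal_of_le_of_mul_self_mem M.sq_mem_GtpXdd h

/-- `Π^tp_Ẋ ⊴ Π^tp_C` (p. 27). [cite: MochizukiEtTh2009, Def 1.7 p.27] -/
theorem dotX_normal (εZ : M.GtpC) : (M.dotX εZ).Normal :=
  M.normal_of_map_GtpXdd_le (M.map_GtpXdd_le_dotX εZ)

/-- `Π^tp_Ċ ⊴ Π^tp_C` (p. 27). [cite: MochizukiEtTh2009, Def 1.7 p.27] -/
theorem dotC_normal (εZ : M.GtpC) : (M.dotC εZ).Normal :=
  M.normal_of_map_GtpXdd_le ((M.map_GtpXdd_le_dotX εZ).trans (M.dotX_le_dotC εZ))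

/-- `Π^tp_Ẋ = Π^tp_Ẍ ∪ Π^tp_Ẍ · ε_Z` ("`Ẍ^log → Ẋ^log` is the quotient by the action of `ε_Z`", p. 27):
membership in `Π^tp_Ẋ`. [cite: MochizukiEtTh2009, Def 1.7 p.27] -/
theorem mem_dotX_iff (εZ g : M.GtpC) :
    g ∈ M.dotX εZ ↔ g ∈ M.GtpXdd.map M.inclX ∨ g * εZ⁻¹ ∈ M.GtpXdd.map M.inclX :=
  haveI := M.map_GtpXdd_normal
  mem_sup_zpowers_iff_of_mul_self_mem (M.sq_mem_GtpXdd εZ)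

/-- `Π^tp_Ċ = Π^tp_Ẋ ∪ Π^tp_Ẋ · (ε_± ε_μ)` ("`Ẋ^log → Ċ^log` is the [stack-theoretic] quotient by the
action of `ε_± · ε_μ`", p. 27): membership in `Π^tp_Ċ`. [cite: MochizukiEtTh2009, Def 1.7 p.27] -/
theorem mem_dotC_iff (εZ g : M.GtpC) :
    g ∈ M.dotC εZ ↔ g ∈ M.dotX εZ ∨ g * (M.epsPM * M.epsMu)⁻¹ ∈ M.dotX εZ :=
  haveI := M.dotX_normal εZ
  mem_sup_zpowers_iff_of_mul_self_mem (M.map_GtpXdd_le_dotX εZ (M.sq_mem_GtpXdd _))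

/-- For admissible `ε_Z ∈ Gal(Ẍ/X)`: `Π^tp_Ẋ ≤ Π^tp_X` (`Ẋ^log → X^log`, p. 27).
[cite: MochizukiEtTh2009, Def 1.7 p.27] -/
theorem dotX_le_range {εZ : M.GtpC} (hZ : M.IsAdmissibleEpsZ εZ) : M.dotX εZ ≤ M.inclX.range :=
  sup_le M.map_GtpXdd_le_range (Subgroup.zpowers_le.2 hZ.1)

/-- `ε_± · ε_μ` does not lie over `X` (`ε_± ∈ Gal(Ẍ/C)` lifts `−1`, `ε_μ ∈ Gal(Ẍ/X)`, p. 27).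
[cite: MochizukiEtTh2009, Def 1.7 p.27] -/
theorem epsPM_mul_epsMu_not_mem_range : M.epsPM * M.epsMu ∉ M.inclX.range := fun h =>
  M.epsPM_not_mem (by
    have h' := M.inclX.range.mul_mem h (M.inclX.range.inv_mem M.epsMu_mem)
    rwa [mul_inv_cancel_right] at h')

/-- **The square of p. 27 is cartesian**: `Π^tp_Ċ ∩ Π^tp_X = Π^tp_Ẋ` for admissible `ε_Z` (`Ẋ → Ċ` of
degree `2` by an automorphism not lying over `X`). [cite: MochizukiEtTh2009, Def 1.7 p.27] -/
theorem dotC_inf_range {εZ : M.GtpC} (hZ : M.IsAdmissibleEpsZ εZ) :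
    M.dotC εZ ⊓ M.inclX.range = M.dotX εZ := by
  refine le_antisymm ?_ (le_inf (M.dotX_le_dotC εZ) (M.dotX_le_range hZ))
  rintro g ⟨hgC, hgX⟩
  rcases (M.mem_dotC_iff εZ g).1 hgC with hg | hg
  · exact hg
  · exfalso
    apply M.epsPM_mul_epsMu_not_mem_range
    have h1 : g * (M.epsPM * M.epsMu)⁻¹ ∈ M.inclX.range := M.dotX_le_range hZ hg
    have key : (g * (M.epsPM * M.epsMu)⁻¹)⁻¹ * g = M.epsPM * M.epsMu := by group
    rw [← key]
    exact M.inclX.range.mul_mem (M.inclX.range.inv_mem h1) hgX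

/-! ### Condition (I) `K = K̈`: `Π^tp_Ÿ = Π^tp_{Y₂}`, `[Π^tp_Y : Π^tp_Ÿ] = 2`, and `Π^tp_Ẍ` from `Π^tp_Ÿ` -/

/-- Under (I) (`q_X^{1/2} ∈ K`, p. 27): `K̈ = K(q_X^{1/2}) = K`. [cite: MochizukiEtTh2009, Def 1.7 p.27] -/
theorem Kdd_eq_K : M.Kdd = M.K := by
  rw [M.toThetaSetting.Kdd_eq_restrictScalars_adjoin_sqrt]
  have h : IntermediateField.adjoin (↥M.K) {M.sqrtqX} = ⊥ := by
    rw [IntermediateField.adjoin_simple_eq_bot_iff, IntermediateField.mem_bot]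
    exact ⟨⟨M.sqrtqX, M.sqrtqX_mem_K⟩, rfl⟩
  rw [h, IntermediateField.restrictScalars_bot_eq_self]

/-- Under (I): `G_K̈ = G_{K₂} = G_K`. [cite: MochizukiEtTh2009, Def 1.7 p.27] -/
theorem GKN_two_eq_GK : M.GKN 2 = M.GK := by
  change (fieldKN M.K M.qX 2).fixingSubgroup = M.K.fixingSubgroup
  exact congrArg IntermediateField.fixingSubgroup M.Kdd_eq_K

/-- Under (I): `Π^tp_Ÿ = Π^tp_{Y₂}` ("`Ÿ := Ÿ₁`", `Ÿ₁ = Y₂ ×_{K̈} J̈₁` with `J̈₁ = K₂ = K̈ = K`, p. 17;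
cf. `ThetaSetting.GtpYdd_eq_GtpYN_two` under `Sec2Hyps`). [cite: MochizukiEtTh2009, §1 p.17] -/
theorem GtpYdd_eq_GtpYN_two : M.GtpYdd = M.GtpYN 2 := by
  change M.GtpYN (2 * 1) ⊓ (M.GJddN 1).comap M.aug.toMonoidHom = _
  rw [M.toThetaSetting.GJddN_one, mul_one, M.GKN_two_eq_GK, M.toThetaSetting.comap_aug_GK, inf_top_eq]

/-- Under (I): `Π^tp_Y = Π^tp_{Y₂} · Δ^tp_Y` (the image of `Π^tp_{Y₂}` in `G_K` is `G_{K₂} = G_K`, p. 13;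
cf. `ThetaSetting.GtpY_eq_sup`). [cite: MochizukiEtTh2009, §1 p.13] -/
theorem GtpY_eq_sup : M.GtpY = M.GtpYN 2 ⊔ (M.GtpY ⊓ M.DeltaTemp) := by
  refine le_antisymm ?_ (sup_le (M.GtpYN_le 2) inf_le_left)
  intro y hy
  have hy' : M.aug.toMonoidHom y ∈ (M.GtpYN 2).map M.aug.toMonoidHom := by
    rw [M.map_aug_GtpYN]
    change M.aug.toMonoidHom y ∈ M.GKN 2
    rw [M.GKN_two_eq_GK]
    exact M.toThetaSetting.aug_mem_GK y
  obtain ⟨y', hy'mem, hyy'⟩ := hy'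
  have hk : y'⁻¹ * y ∈ M.DeltaTemp := by
    change y'⁻¹ * y ∈ M.aug.toMonoidHom.ker
    rw [MonoidHom.mem_ker, map_mul, map_inv, hyy', inv_mul_cancel]
  have hmem : y'⁻¹ * y ∈ M.GtpY ⊓ M.DeltaTemp :=
    Subgroup.mem_inf.2 ⟨M.GtpY.mul_mem (M.GtpY.inv_mem (M.GtpYN_le 2 hy'mem)) hy, hk⟩
  have : y = y' * (y'⁻¹ * y) := by group
  rw [this]
  exact mul_mem (Subgroup.mem_sup_left hy'mem) (Subgroup.mem_sup_right hmem)

/-- Under (I): **`[Π^tp_Y : Π^tp_Ÿ] = 2`** (`Δ^tp_Y/Δ^tp_{Y₂} ≅ ℤ/2ℤ(1)`, p. 16, and `K₂ = K`; cf.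
`ThetaSetting.relIndex_GtpYdd_GtpY` under `Sec2Hyps`). [cite: MochizukiEtTh2009, §1 p.16] -/
theorem relIndex_GtpYdd_GtpY : M.GtpYdd.relIndex M.GtpY = 2 := by
  haveI := M.GtpYN_normal 2
  rw [M.GtpYdd_eq_GtpYN_two]
  conv_lhs => rw [M.GtpY_eq_sup]
  rw [Subgroup.relIndex_sup_left, ← Subgroup.inf_relIndex_right]
  have hle : M.GtpYN 2 ≤ M.GtpY := M.GtpYN_le 2
  have : M.GtpYN 2 ⊓ (M.GtpY ⊓ M.DeltaTemp) = M.GtpYN 2 ⊓ M.DeltaTemp := by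
    rw [← inf_assoc, inf_eq_left.2 hle]
  rw [this]
  exact_mod_cast M.relIndex_deltaYN 2

/-- The subgroup `{g | toZ(g) even} ⊆ Π^tp_X` (the double covering of `X` inside `Y → X`) has index `2`
(`Π^tp_X/Π^tp_Y ≅ Z ≅ ℤ`, p. 12). [cite: MochizukiEtTh2009, §1 p.12] -/
theorem index_comap_toZ_two :
    ((AddSubgroup.zmultiples (2 : ℤ)).toSubgroup.comap M.toZ).index = 2 := by
  obtain ⟨t, ht⟩ := M.toZ_surjective (Multiplicative.ofAdd 1)
  rw [Subgroup.index_eq_two_iff]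
  refine ⟨t, fun b => ?_⟩
  simp only [Subgroup.mem_comap, Multiplicative.mem_toSubgroup, map_mul, ht, toAdd_mul, toAdd_ofAdd,
    Int.mem_zmultiples_iff]
  rcases Int.even_or_odd (Multiplicative.toAdd (M.toZ b)) with ⟨m, hm⟩ | ⟨m, hm⟩
  · rw [hm]; exact Or.inr ⟨⟨m, by ring⟩, fun ⟨k, hk⟩ => by omega⟩
  · rw [hm]; exact Or.inl ⟨⟨m + 1, by ring⟩, fun ⟨k, hk⟩ => by omega⟩

/-- Under (I): **`Π^tp_Ẍ` is the normal subgroup of `Π^tp_X` generated by `Π^tp_Ÿ` and the squares**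
(from "`Ẍ^log → X^log` of degree `4` determined by the multiplication by `2` map", `Ÿ^log → Ẍ^log`,
p. 27, and `[Π^tp_Y : Π^tp_Ÿ] = 2`, `Π^tp_X/Π^tp_Y ≅ ℤ`: both sides have index `4`).
[cite: MochizukiEtTh2009, Def 1.7 p.27] -/
theorem GtpXdd_eq_normalClosure :
    M.GtpXdd = Subgroup.normalClosure ((M.GtpYdd : Set M.PiTemp) ∪ Set.range fun g => g * g) := by
  set S := Subgroup.normalClosure ((M.GtpYdd : Set M.PiTemp) ∪ Set.range fun g : M.PiTemp => g * g)
    with hSdef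
  haveI := M.GtpXdd_normal
  -- `S ≤ Π^tp_Ẍ`
  have hSle : S ≤ M.GtpXdd := by
    apply Subgroup.normalClosure_le_normal
    rintro x (hx | ⟨g, rfl⟩)
    · exact M.GtpYdd_le_GtpXdd hx
    · exact M.mul_self_mem_GtpXdd g
  have hYdd : M.GtpYdd ≤ S := fun x hx => Subgroup.subset_normalClosure (Or.inl hx)
  have hsq : ∀ g : M.PiTemp, g * g ∈ S := fun g => Subgroup.subset_normalClosure (Or.inr ⟨g, rfl⟩)
  -- `[Π^tp_Y · S : S]` divides `2`
  have h1 : S.relIndex (S ⊔ M.GtpY) ∣ 2 := by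
    rw [Subgroup.relIndex_sup_left, ← M.relIndex_GtpYdd_GtpY]
    exact Subgroup.relIndex_dvd_of_le_left M.GtpY hYdd
  -- `[Π^tp_X : Π^tp_Y · S]` divides `2`
  have h2 : (S ⊔ M.GtpY).index ∣ 2 := by
    rw [← M.index_comap_toZ_two]
    apply Subgroup.index_dvd_of_le
    intro g hg
    simp only [Subgroup.mem_comap, Multiplicative.mem_toSubgroup, Int.mem_zmultiples_iff] at hg
    obtain ⟨k, hk⟩ := hg
    obtain ⟨t, ht⟩ := M.toZ_surjective (Multiplicative.ofAdd 1)
    have htt : M.toZ ((t * t) ^ k) = M.toZ g := by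
      apply Multiplicative.toAdd.injective
      rw [map_zpow, map_mul, ht, hk, toAdd_zpow, toAdd_mul, toAdd_ofAdd, smul_eq_mul]
      ring
    have hker : g * ((t * t) ^ k)⁻¹ ∈ M.GtpY := by
      change g * ((t * t) ^ k)⁻¹ ∈ M.toZ.ker
      rw [MonoidHom.mem_ker, map_mul, map_inv, htt, mul_inv_cancel]
    have : g = g * ((t * t) ^ k)⁻¹ * (t * t) ^ k := by group
    rw [this]
    exact mul_mem (Subgroup.mem_sup_right hker) (Subgroup.mem_sup_left (S.zpow_mem (hsq t) k))
  -- hence `[Π^tp_X : S]` divides `4 = [Π^tp_X : Π^tp_Ẍ]`, and `S ≤ Π^tp_Ẍ` forces equality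
  have h3 : S.index ∣ 4 := by
    rw [← Subgroup.relIndex_mul_index (le_sup_left : S ≤ S ⊔ M.GtpY)]
    exact mul_dvd_mul h1 h2
  have h4 : S.relIndex M.GtpXdd * 4 ∣ 4 := by
    rw [← M.index_GtpXdd, Subgroup.relIndex_mul_index hSle, M.index_GtpXdd]
    exact h3
  have h5 : S.relIndex M.GtpXdd = 1 := by
    have : S.relIndex M.GtpXdd ∣ 1 := by
      rwa [← Nat.mul_dvd_mul_iff_right (by norm_num : 0 < 4), one_mul]
    exact Nat.dvd_one.mp this
  exact le_antisymm (Subgroup.relIndex_eq_one.mp h5) hSle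

/-- **Thm. 1.6 (i) already controls `Π^tp_Ẍ`**: an isomorphism `Π^tp_{Xα} →̃ Π^tp_{Xβ}` (of the underlying
groups) carrying `Π^tp_{Ÿα}` onto `Π^tp_{Ÿβ}` carries `Π^tp_{Ẍα}` onto `Π^tp_{Ẍβ}` (p. 29: "`γ` is also
compatible with the subgroups `Π^tp_Ÿ ⊆ Π^tp_Ẍ ⊆ Π^tp_X`"). [cite: MochizukiEtTh2009, Prop 1.8 p.29] -/
theorem map_GtpXdd_eq_of_map_GtpYdd_eq {Mα Mβ : MuTwoSetting p} (e : Mα.PiTemp ≃* Mβ.PiTemp)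
    (h : Mα.GtpYdd.map e.toMonoidHom = Mβ.GtpYdd) : Mα.GtpXdd.map e.toMonoidHom = Mβ.GtpXdd := by
  have key : ∀ {Mα Mβ : MuTwoSetting p} (e : Mα.PiTemp ≃* Mβ.PiTemp),
      Mα.GtpYdd.map e.toMonoidHom = Mβ.GtpYdd → Mα.GtpXdd.map e.toMonoidHom ≤ Mβ.GtpXdd := by
    intro Mα Mβ e h
    rw [Mα.GtpXdd_eq_normalClosure, Subgroup.map_le_iff_le_comap]
    haveI := Mβ.GtpXdd_normal
    apply Subgroup.normalClosure_le_normal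
    rintro x (hx | ⟨g, rfl⟩)
    · rw [SetLike.mem_coe, Subgroup.mem_comap]
      exact Mβ.GtpYdd_le_GtpXdd (h ▸ ⟨x, hx, rfl⟩)
    · rw [SetLike.mem_coe, Subgroup.mem_comap, map_mul]
      exact Mβ.mul_self_mem_GtpXdd _
  refine le_antisymm (key e h) ?_
  have h' : Mβ.GtpYdd.map e.symm.toMonoidHom = Mα.GtpYdd := by
    rw [← h, Subgroup.map_map]
    have : e.symm.toMonoidHom.comp e.toMonoidHom = MonoidHom.id _ := by
      ext x; simp
    rw [this, Subgroup.map_id]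
  intro y hy
  exact ⟨e.symm y, key e.symm h' ⟨y, hy, rfl⟩, e.apply_symm_apply y⟩

end MuTwoSetting

end Literature.AnabelianGeometry.EtaleTheta
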